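import Mathlib
import Summits.ResolutionOfSingularities.ResolutionOfSingularities.Theorems.RadicialJungCleanModelsCleanProp44NearLineSchemeCorner
import HarnessLib

/-!
# Route `RadicialJung`, crux `CleanModels` (stmt-ResolutionOfSingularities-15917), line `Sketch` rev 35, stub 6 `stub_cleanProp44` (X44c):
# CLEAN-PERMISSIBILITY OF NEAR LINES, VI — THE LOCAL CLASSIFICATION «permissible ∨ corner ∨ tangent side ∨ birth»

Seat decomp-res-hand-2 g18 (structural hand).  Capstone of lemma (ii) of hand-2 g17's census of the Phase II residual (R1ᵐⁱⁿ)
(`Cruxes/CleanModels/Lines/Sketch-memo-hand2-g17-stubs-5-7.md` §2 (a)), assembling ✓ `…CleanProp44NearLineScheme{,Side,Corner}.lean`: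

* `cleanPermissibleAt_exceptionalCurve_or_obstruction` — `τ : X' → X` a blowing up along `J` (`IsBlowup`), `x' ∈ X'` over `x = τ x'`, the line
  of `G` clean-permissible at `x` for `J_x` in form (1) (`(c, w)`, `u`, `a`, `b = 0`) with EVERY shown exponent `a_k` zero or prime to `p` (the
  currency of ✓ `cleanPermissible_of_cleanRegAt`: forms (1) AND (2) of `CleanRegAt` at a blown-up closed point), `dim 𝒪_{X',x'} = 3`, and
  `N = (e', z)` a regular curve germ of the exceptional divisor through `x'` (`(e') = J_x 𝒪_{X',x'}`, `(e', z, z')` a regular system of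
  parameters).  Then EXACTLY ONE of the following is available: the line of `τ^♯ G` is CLEAN-PERMISSIBLE at `x'` for `N`; or `x'` is a CORNER of
  the clean divisor on the exceptional divisor met by `N` in a non-axis direction (two clean sides `V(c_{k₁})`, `V(c_{k₂})` through `x'`, neither of
  them `N`); or a clean side through `x'` is TANGENT to `N` (`s ∈ (N + 𝔪²) ∖ N`; impossible for two distinct LINES of `E_x ≅ ℙ²`, but the
  projective structure is the consumer's); or `x'` is a BIRTH of `N` (no side through `x'`, `p ∣ Σ a_k`, the unit `U` presenting the transform as
  `U · e'^A` has `p`-th power residue and every `U - c'^p ∈ 𝔪` lies in `(N + 𝔪²) ∖ N`; memo 4e §2.4 (B2)/(B5)).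
  «Exactly one» is not claimed; the three obstructions are the honest residue, each NOT clean-permissible in general
  (✓ `not_cleanPermissibleAt_diagonal_cornerWitness`, ✓ `not_cleanPermissibleAt_contactOrder`, ✓ `not_cleanPermissibleAt_of_derivations`).

Honest framing: OURS; a TOOL for the (R1ᵐⁱⁿ)/(R3ᵐⁱⁿ′) provers (termination of «insert – blow up – new near lines» is NOT addressed).  Nothing
here proves X44c, any case of `CleanModels`, or resolution of singularities in characteristic `p`.  Setting only: [cite: Piltant2013, §2 Axiom 4]
[cite: CossartPiltant2008, Lemma 4.3 (5); Prop. 4.4 (proof, p. 11)] [cite: GortzWedhorn2020, Prop. 13.91].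
-/

noncomputable section

set_option linter.dupNamespace false -- mandated namespace of this single-conjunct summit

open IsLocalRing CategoryTheory AlgebraicGeometry
open Literature.AlgebraicGeometry.Resolution Literature.AlgebraicGeometry.Motives

namespace Summit.ResolutionOfSingularities.ResolutionOfSingularities.Theorems.RadicialJung.CleanModels

universe u

section Scheme

variable {p : ℕ} {X X' : Scheme.{u}} [IsIntegral X] [IsIntegral X'] {τ : X' ⟶ X} [IsDominant τ]
  {J : X.IdealSheafData}

set_option maxHeartbeats 800000 in
-- one long case analysis over the normal form of the transform
/-- **THE LOCAL CLASSIFICATION at a point of the exceptional divisor: clean-permissible, or corner, or tangent side, or birth.**  See the module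
docstring. [cite: Piltant2013, §2 Axiom 4] [cite: CossartPiltant2008, Lemma 4.3 (5); Prop. 4.4 (proof, p. 11)] -/
theorem cleanPermissibleAt_exceptionalCurve_or_obstruction [Fact p.Prime] [CharP X'.functionField p] (hτ : IsBlowup τ J) (x' : X')
    (hR : IsRegularLocalRing (X.presheaf.stalk (τ x'))) {n l : ℕ} (c : Fin n → X.presheaf.stalk (τ x'))
    (w : Fin l → X.presheaf.stalk (τ x')) (hz : Ideal.span (Set.range (Fin.append c w)) = maximalIdeal (X.presheaf.stalk (τ x')))
    (hdim : ringKrullDim (X.presheaf.stalk (τ x')) = ((n + l : ℕ) : WithBot ℕ∞))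
    (hcJ : Ideal.span (Set.range c) = stalkIdeal J (τ x'))
    {G : X.functionField} {cc : Fin p → X.functionField} (hcc : ∃ j : Fin p, (j : ℕ) ≠ 0 ∧ cc j ≠ 0)
    {u : X.presheaf.stalk (τ x')} (hu : IsUnit u) {a : Fin n → ℕ} {b : Fin l → ℕ}
    (hrep : (∑ j : Fin p, cc j ^ p * G ^ (j : ℕ)) = RatFn.toFunctionField (τ x') (u * (∏ k, c k ^ a k) * ∏ m, w m ^ b m))
    (hb : ∀ m, b m = 0) (hall : ∀ k, a k = 0 ∨ ¬ p ∣ a k)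
    (hdim' : ringKrullDim (X'.presheaf.stalk x') = 3) {e' z z' : X'.presheaf.stalk x'}
    (he' : Ideal.span {e'} = (stalkIdeal J (τ x')).map (τ.stalkMap x').hom)
    (hzz : Ideal.span ({e', z, z'} : Set (X'.presheaf.stalk x')) = maximalIdeal (X'.presheaf.stalk x')) :
    CleanPermissibleAt p (RatFn.toFunctionField x') (RatFn.functionFieldMap τ G) (Ideal.span ({e', z} : Set (X'.presheaf.stalk x'))) ∨
    (∃ (k₁ k₂ : Fin n) (s₁ s₂ : X'.presheaf.stalk x'), k₁ ≠ k₂ ∧ a k₁ ≠ 0 ∧ a k₂ ≠ 0 ∧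
        (τ.stalkMap x').hom (c k₁) = e' * s₁ ∧ (τ.stalkMap x').hom (c k₂) = e' * s₂ ∧
        Ideal.span ({e', s₁, s₂} : Set (X'.presheaf.stalk x')) = maximalIdeal (X'.presheaf.stalk x') ∧
        s₁ ∉ Ideal.span ({e', z} : Set (X'.presheaf.stalk x')) ∧ s₂ ∉ Ideal.span ({e', z} : Set (X'.presheaf.stalk x'))) ∨
    (∃ (k : Fin n) (s : X'.presheaf.stalk x'), a k ≠ 0 ∧ (τ.stalkMap x').hom (c k) = e' * s ∧ s ∈ maximalIdeal (X'.presheaf.stalk x') ∧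
        s ∉ Ideal.span ({e', z} : Set (X'.presheaf.stalk x')) ∧
        s ∈ Ideal.span ({e', z} : Set (X'.presheaf.stalk x')) ⊔ maximalIdeal (X'.presheaf.stalk x') ^ 2) ∨
    (p ∣ ∑ k, a k ∧ (∀ k, a k ≠ 0 → Ideal.span {(τ.stalkMap x').hom (c k)} = (stalkIdeal J (τ x')).map (τ.stalkMap x').hom) ∧
      ∃ U : X'.presheaf.stalk x', IsUnit U ∧
        (∑ j : Fin p, RatFn.functionFieldMap τ (cc j) ^ p * RatFn.functionFieldMap τ G ^ (j : ℕ)) =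
          RatFn.toFunctionField x' (U * e' ^ (∑ k, a k)) ∧
        ¬ ((∀ c' : X'.presheaf.stalk x', U - c' ^ p ∉ maximalIdeal (X'.presheaf.stalk x')) ∨
          (∃ c' : X'.presheaf.stalk x', U - c' ^ p ∈ maximalIdeal (X'.presheaf.stalk x') ∧
            U - c' ^ p ∉ Ideal.span ({e', z} : Set (X'.presheaf.stalk x')) ⊔ maximalIdeal (X'.presheaf.stalk x') ^ 2) ∨
          (∃ c' : X'.presheaf.stalk x', U - c' ^ p ∈ Ideal.span ({e', z} : Set (X'.presheaf.stalk x')) ∧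
            U - c' ^ p ∉ maximalIdeal (X'.presheaf.stalk x') ^ 2))) := by
  classical
  obtain ⟨i, uf, m, jJ, hrel, -, hjJ, hch, hcomplete, hrsop, U, hU, -, heq⟩ :=
    exists_transform_normalForm_of_isBlowup hτ x' hR c w hz hdim hcJ a b hu
  have hR' : IsRegularLocalRing (X'.presheaf.stalk x') := hrsop.isRegularLocalRing
  haveI := isDomain_of_isRegularLocalRing (X'.presheaf.stalk x')
  have hei : (τ.stalkMap x').hom (c i) ≠ 0 := by simpa using hrsop.ne_zero 0
  have hE : Ideal.span {(τ.stalkMap x').hom (c i)} = (stalkIdeal J (τ x')).map (τ.stalkMap x').hom := by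
    rw [← hcJ]; exact span_singleton_eq_map_span_of_rel _ c i uf hrel
  obtain ⟨v, hv⟩ : Associated e' ((τ.stalkMap x').hom (c i)) := Ideal.span_singleton_eq_span_singleton.mp (he'.trans hE.symm)
  have he'0 : e' ≠ 0 := left_ne_zero_of_mul (hv.symm ▸ hei)
  -- a side `V(c_k)` not among the charged fractions does not pass through `x'`
  have hpass : ∀ k, (∀ q, (jJ q).1 ≠ k) → Ideal.span {(τ.stalkMap x').hom (c k)} = (stalkIdeal J (τ x')).map (τ.stalkMap x').hom := by
    intro k hq
    by_cases hki : k = i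
    · rw [hki]; exact hE
    · have hufk : IsUnit (uf k) := by
        by_contra hunit
        obtain ⟨q, hq'⟩ := hcomplete k hki ((mem_maximalIdeal _).mpr hunit)
        exact hq q hq'
      rw [hrel, Ideal.span_singleton_mul_right_unit hufk, hE]
  -- the charged fractions presented as `e' · s`
  have hside : ∀ q, (τ.stalkMap x').hom (c (jJ q).1) = e' * (↑v * uf (jJ q).1) ∧ ↑v * uf (jJ q).1 ∈ maximalIdeal (X'.presheaf.stalk x') :=
    fun q => ⟨by rw [hrel, ← hv, mul_assoc], Ideal.mul_mem_left _ _ (hch q)⟩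
  obtain ⟨hcc', hrep'⟩ := rep_functionFieldMap x' hcc hrep
  by_cases h0 : ∀ q, a (jJ q).1 = 0
  · -- NO side through `x'`
    have hsides : ∀ k, a k ≠ 0 → Ideal.span {(τ.stalkMap x').hom (c k)} = (stalkIdeal J (τ x')).map (τ.stalkMap x').hom :=
      fun k hk => hpass k fun q hq => hk (hq ▸ h0 q)
    by_cases hA : p ∣ ∑ k, a k
    · have hprod1 : ∏ q, uf (jJ q).1 ^ a (jJ q).1 = 1 := Finset.prod_eq_one fun q _ => by rw [h0 q, pow_zero]
      have hprod2 : ∏ m', (τ.stalkMap x').hom (w m') ^ b m' = 1 := Finset.prod_eq_one fun m' _ => by rw [hb m', pow_zero]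
      have heq' : (τ.stalkMap x').hom (u * (∏ k, c k ^ a k) * ∏ m', w m' ^ b m') = (U * ↑v ^ (∑ k, a k)) * e' ^ (∑ k, a k) := by
        rw [heq, hprod1, hprod2, mul_one, mul_one, ← hv, mul_pow]; ring
      rw [heq'] at hrep'
      have hU' : IsUnit (U * ↑v ^ (∑ k, a k)) := hU.mul ((Units.isUnit v).pow _)
      by_cases hnb : (∀ c' : X'.presheaf.stalk x', U * ↑v ^ (∑ k, a k) - c' ^ p ∉ maximalIdeal (X'.presheaf.stalk x')) ∨
          (∃ c' : X'.presheaf.stalk x', U * ↑v ^ (∑ k, a k) - c' ^ p ∈ maximalIdeal (X'.presheaf.stalk x') ∧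
            U * ↑v ^ (∑ k, a k) - c' ^ p ∉ Ideal.span ({e', z} : Set (X'.presheaf.stalk x')) ⊔ maximalIdeal (X'.presheaf.stalk x') ^ 2) ∨
          (∃ c' : X'.presheaf.stalk x', U * ↑v ^ (∑ k, a k) - c' ^ p ∈ Ideal.span ({e', z} : Set (X'.presheaf.stalk x')) ∧
            U * ↑v ^ (∑ k, a k) - c' ^ p ∉ maximalIdeal (X'.presheaf.stalk x') ^ 2)
      · left
        have hrepU := rep_eq_mul_pow_of_dvd (RatFn.toFunctionField x') (fun j => RatFn.functionFieldMap τ (cc j)) hA hrep'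
        have hd : RatFn.toFunctionField x' e' ^ ((∑ k, a k) / p) ≠ 0 :=
          pow_ne_zero _ ((map_ne_zero_iff _ (RatFn.toFunctionField_injective x')).mpr he'0)
        exact cleanPermissibleAt_of_unit_rep (RatFn.toFunctionField x') hR' hdim' hzz _ hcc' hU' hd hrepU hnb
      · right; right; right
        exact ⟨hA, hsides, _, hU', hrep', hnb⟩
    · left
      exact cleanPermissibleAt_exceptionalCurve_of_not_dvd hτ x' hR c w hz hdim hcJ hcc hu hrep hb hsides hA hdim' he' hzz
  · -- at least one side through `x'`
    push Not at h0
    obtain ⟨q₀, hq₀⟩ := h0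
    obtain ⟨hs₀, hs₀m⟩ := hside q₀
    have hexp₀ : ¬ p ∣ a (jJ q₀).1 := (hall _).resolve_left hq₀
    by_cases h1 : ∀ q, q ≠ q₀ → a (jJ q).1 = 0
    · -- EXACTLY one side through `x'`
      have hothers : ∀ k, k ≠ (jJ q₀).1 → a k ≠ 0 →
          Ideal.span {(τ.stalkMap x').hom (c k)} = (stalkIdeal J (τ x')).map (τ.stalkMap x').hom := by
        intro k hk hak
        refine hpass k fun q hq => ?_
        by_cases hqq : q = q₀
        · exact hk (by rw [← hq, hqq])
        · exact hak (hq ▸ h1 q hqq)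
      rcases side_trichotomy hzz hs₀m with htr | hmem
      · left
        exact cleanPermissibleAt_exceptionalCurve_of_side_transversal hτ x' hR c w hz hdim hcJ hcc hu hrep hb (jJ q₀).1 hothers
          (Or.inr hexp₀) hdim' he' htr hs₀
      · by_cases hN : ↑v * uf (jJ q₀).1 ∈ Ideal.span ({e', z} : Set (X'.presheaf.stalk x'))
        · left
          exact cleanPermissibleAt_exceptionalCurve_of_side_mem hτ x' hR c w hz hdim hcJ hcc hu hrep hb (jJ q₀).1 hothers (Or.inr hexp₀)
            hdim' he' hzz hs₀ hN
        · right; right; left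
          exact ⟨(jJ q₀).1, _, hq₀, hs₀, hs₀m, hN, hmem⟩
    · -- TWO sides through `x'` (and then no third: the chart family has at most `3` members)
      push Not at h1
      obtain ⟨q₁, hq₁₀, hq₁⟩ := h1
      obtain ⟨hs₁, hs₁m⟩ := hside q₁
      have hexp₁ : ¬ p ∣ a (jJ q₁).1 := (hall _).resolve_left hq₁
      have hk : (jJ q₀).1 ≠ (jJ q₁).1 := fun h => hq₁₀ (hjJ (Subtype.ext h)).symm
      have hm : m ≤ 2 := by
        have h1 := hrsop.natCast_le_ringKrullDim_of_isRsopPart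
        rw [hdim'] at h1
        have h2 : m + l + 1 ≤ 3 := by exact_mod_cast h1
        omega
      have hq01 : ∀ q, q = q₀ ∨ q = q₁ := by
        intro q
        by_contra h
        push Not at h
        have h3 : ({q, q₀, q₁} : Finset (Fin m)).card = 3 := by
          rw [Finset.card_insert_of_notMem (by simp [h.1, h.2]), Finset.card_insert_of_notMem (by simpa using hq₁₀.symm),
            Finset.card_singleton]
        have h4 := Finset.card_le_univ ({q, q₀, q₁} : Finset (Fin m))
        rw [h3, Fintype.card_fin] at h4
        omega
      have hothers : ∀ k, k ≠ (jJ q₀).1 → k ≠ (jJ q₁).1 → a k ≠ 0 →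
          Ideal.span {(τ.stalkMap x').hom (c k)} = (stalkIdeal J (τ x')).map (τ.stalkMap x').hom := by
        intro k hk₀ hk₁ _
        refine hpass k fun q hq => ?_
        rcases hq01 q with rfl | rfl
        · exact hk₀ hq.symm
        · exact hk₁ hq.symm
      have he'm : e' ∈ maximalIdeal (X'.presheaf.stalk x') := hzz ▸ Ideal.subset_span (by simp)
      have hzm : z ∈ maximalIdeal (X'.presheaf.stalk x') := hzz ▸ Ideal.subset_span (by simp)
      -- `(e', s₀, s₁)` generates `𝔪`
      have h𝔪 : Ideal.span ({e', ↑v * uf (jJ q₀).1, ↑v * uf (jJ q₁).1} : Set (X'.presheaf.stalk x')) =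
          maximalIdeal (X'.presheaf.stalk x') := by
        have htriple : IsRsopPart ![e', ↑v * uf (jJ q₀).1, ↑v * uf (jJ q₁).1] := by
          have hinj : Function.Injective (![0, Fin.succ (Fin.castAdd l q₀), Fin.succ (Fin.castAdd l q₁)] : Fin 3 → Fin (m + l + 1)) := by
            have hne01 : Fin.succ (Fin.castAdd l q₀) ≠ Fin.succ (Fin.castAdd l q₁) := fun h =>
              hq₁₀ (Fin.castAdd_injective _ _ (Fin.succ_injective _ h)).symm
            intro t₁ t₂ h
            fin_cases t₁ <;> fin_cases t₂
            all_goals (first | rfl | (exfalso; simp only [Fin.zero_eta, Fin.mk_one, Fin.reduceFinMk, Matrix.cons_val_zero, Matrix.cons_val_one,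
              Matrix.cons_val_two, Matrix.tail_cons, Matrix.head_cons] at h; first
                | exact Fin.succ_ne_zero _ h | exact Fin.succ_ne_zero _ h.symm | exact hne01 h | exact hne01 h.symm))
          have h1 := hrsop.comp _ hinj
          have h2 : (Fin.cons ((τ.stalkMap x').hom (c i)) (Fin.append (fun q => uf (jJ q).1) fun m' => (τ.stalkMap x').hom (w m')) :
              Fin (m + l + 1) → X'.presheaf.stalk x') ∘
              (![0, Fin.succ (Fin.castAdd l q₀), Fin.succ (Fin.castAdd l q₁)] : Fin 3 → Fin (m + l + 1)) =
              ![(τ.stalkMap x').hom (c i), uf (jJ q₀).1, uf (jJ q₁).1] := by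
            funext t
            fin_cases t
            · rfl
            · simp only [Function.comp_apply, Fin.mk_one, Matrix.cons_val_one, Matrix.cons_val_zero, Fin.cons_succ, Fin.append_left]
            · simp only [Function.comp_apply, Fin.reduceFinMk, Matrix.cons_val, Fin.cons_succ, Fin.append_left]
          rw [h2] at h1
          refine h1.of_associated fun t => ?_
          fin_cases t
          · change Associated ((τ.stalkMap x').hom (c i)) e'
            exact ⟨v⁻¹, by rw [← hv, mul_assoc, Units.mul_inv, mul_one]⟩
          · change Associated (uf (jJ q₀).1) (↑v * uf (jJ q₀).1)
            exact ⟨v, by rw [mul_comm]⟩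
          · change Associated (uf (jJ q₁).1) (↑v * uf (jJ q₁).1)
            exact ⟨v, by rw [mul_comm]⟩
        have hr : Set.range ![e', ↑v * uf (jJ q₀).1, ↑v * uf (jJ q₁).1] = {e', ↑v * uf (jJ q₀).1, ↑v * uf (jJ q₁).1} := by
          ext t
          simp only [Set.mem_range, Set.mem_insert_iff, Set.mem_singleton_iff]
          constructor
          · rintro ⟨j, rfl⟩
            fin_cases j <;> simp
          · rintro (rfl | rfl | rfl)
            exacts [⟨0, rfl⟩, ⟨1, rfl⟩, ⟨2, rfl⟩]
        rw [← hr]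
        exact IsRsopPart.span_range_eq_maximalIdeal_of_ringKrullDim_eq htriple (by rw [hdim']; norm_cast)
      by_cases hN₀ : ↑v * uf (jJ q₀).1 ∈ Ideal.span ({e', z} : Set (X'.presheaf.stalk x'))
      · left
        exact cleanPermissibleAt_exceptionalCurve_of_two_sides hτ x' hR c w hz hdim hcJ hcc hu hrep hb hk hothers (Or.inr (Or.inl hexp₀))
          hdim' he' he'm hzm hs₀ hs₁ hs₀m hs₁m hN₀
      · by_cases hN₁ : ↑v * uf (jJ q₁).1 ∈ Ideal.span ({e', z} : Set (X'.presheaf.stalk x'))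
        · left
          have hothers' : ∀ k, k ≠ (jJ q₁).1 → k ≠ (jJ q₀).1 → a k ≠ 0 →
              Ideal.span {(τ.stalkMap x').hom (c k)} = (stalkIdeal J (τ x')).map (τ.stalkMap x').hom :=
            fun k h₁ h₀ hak => hothers k h₀ h₁ hak
          exact cleanPermissibleAt_exceptionalCurve_of_two_sides hτ x' hR c w hz hdim hcJ hcc hu hrep hb hk.symm hothers'
            (Or.inr (Or.inl hexp₁)) hdim' he' he'm hzm hs₁ hs₀ hs₁m hs₀m hN₁
        · right; left
          exact ⟨(jJ q₀).1, (jJ q₁).1, _, _, hk, hq₀, hq₁, hs₀, hs₁, h𝔪, hN₀, hN₁⟩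

end Scheme

end Summit.ResolutionOfSingularities.ResolutionOfSingularities.Theorems.RadicialJung.CleanModels

end
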